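import Literature.NumberTheory.PAdicHodge.FontaineThetaLocalField
import Mathlib.RingTheory.WittVector.TeichmullerSeries
import HarnessLib

/-!
# The `Γ_F`-action on `𝒪_{ℂ_F}♭` and on `𝔸_inf(F)`, and the `Γ_F`-equivariance of Fontaine's `θ`

For a nonarchimedean local field `F` of residue characteristic `p`, the absolute Galois group
`Γ_F` acts on `𝒪_{ℂ_F}` (`galInt σ`, by isometries), hence on `𝒪_{ℂ_F}/p`, on the tilt
`𝒪_{ℂ_F}♭ = lim_{x ↦ x^p} 𝒪_{ℂ_F}/p` (coefficientwise) and on `𝔸_inf(F) = 𝕎(𝒪_{ℂ_F}♭)`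
(functoriality of Witt vectors).  We construct these actions and prove the two basic
compatibilities of Fontaine's theory (Fontaine, *Le corps des périodes p-adiques*, Exp. II §1.2):

* `untilt_galTilt` : the sharp map `x ↦ x♯` (`PreTilt.untilt`) is `Γ_F`-equivariant;
* `fontaineTheta_galAinf` : **`θ ∘ σ = σ ∘ θ`** on `𝔸_inf(F)`, i.e. Fontaine's `θ` is
  `Γ_F`-equivariant; in particular `ker θ` is `Γ_F`-stable (`galAinf_mem_ker_fontaineTheta`).

The hypotheses `Fact (¬ IsUnit (p : 𝒪_{ℂ_F}))` and `IsAdicComplete (p) 𝒪_{ℂ_F}` are taken as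
instance arguments; they are discharged from `valuation F p < 1` by
`not_isUnit_natCast_integerC` and `isAdicComplete_integerC_natCast`
(file `FontaineThetaLocalField`).

## References
* [FontaineAsterisque223III] J.-M. Fontaine, *Le corps des périodes p-adiques*, Astérisque 223
  (1994), Exp. II, §1.2.
* [FontaineOuyang2022] J.-M. Fontaine, Y. Ouyang, *Theory of p-adic Galois representations*
  (book draft), §4.2–§4.4.
-/

noncomputable section

open ValuativeRel Field Ideal WittVector

namespace Literature.NumberTheory.PAdicHodge

open Literature.NumberTheory.GaloisRepresentations
open Literature.NumberTheory.GaloisRepresentations.IsNonarchimedeanLocalField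

variable {F : Type} [Field F] [ValuativeRel F] [TopologicalSpace F] [IsNonarchimedeanLocalField F] {p : ℕ}

/-! ### Functoriality of `galInt` -/

/-- `galInt 1 = id`. [folklore] -/
theorem galInt_one (x : integerC F) : galInt (1 : absoluteGaloisGroup F) x = x :=
  Subtype.ext <| (coe_galInt 1 x).trans (one_smul _ _)

/-- `galInt (σ τ) = galInt σ ∘ galInt τ`. [folklore] -/
theorem galInt_mul (σ τ : absoluteGaloisGroup F) (x : integerC F) :
    galInt (σ * τ) x = galInt σ (galInt τ x) :=
  Subtype.ext <| by rw [coe_galInt, coe_galInt, coe_galInt, mul_smul]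

/-- `galInt σ` fixes every `n : ℕ`. [folklore] -/
theorem galInt_natCast (σ : absoluteGaloisGroup F) (n : ℕ) : galInt σ (n : integerC F) = n :=
  map_natCast _ _

variable (p) in
/-- Two elements of `𝒪_{ℂ_F}` congruent modulo every `pⁿ` are equal (`p`-adic separatedness).
[folklore] -/
theorem eq_of_forall_sub_mem_span_natCast_pow [IsAdicComplete (Ideal.span {(p : integerC F)}) (integerC F)]
    {x y : integerC F} (h : ∀ n, x - y ∈ Ideal.span {(p : integerC F)} ^ n) : x = y := by
  rw [← sub_eq_zero]
  refine IsHausdorff.haus (IsAdicComplete.toIsHausdorff (I := Ideal.span {(p : integerC F)})) (x - y)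
    fun n => ?_
  rw [SModEq.zero, span_pow_smul_top]
  exact h n

/-- `p` is nilpotent in `𝒪_{ℂ_F}/p^(n+1)`. [folklore] -/
theorem isNilpotent_natCast_quotient_pow (n : ℕ) :
    IsNilpotent ((p : integerC F ⧸ Ideal.span {(p : integerC F)} ^ (n + 1))) := by
  refine ⟨n + 1, ?_⟩
  rw [← map_natCast (Ideal.Quotient.mk (Ideal.span {(p : integerC F)} ^ (n + 1))), ← map_pow,
    Ideal.Quotient.eq_zero_iff_mem]
  exact Ideal.pow_mem_pow (Ideal.mem_span_singleton_self _) _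

/-! ### The action on `𝒪_{ℂ_F}/p` -/

/-- **`σ mod p`**: the ring endomorphism of `𝒪_{ℂ_F}/p` induced by `galInt σ`.
[cite: FontaineAsterisque223III, Exp. II §1.2] -/
def galModP (σ : absoluteGaloisGroup F) : ModP (integerC F) p →+* ModP (integerC F) p :=
  Ideal.quotientMap (Ideal.span {(p : integerC F)}) (galInt σ) <| by
    rw [Ideal.span_le, Set.singleton_subset_iff, SetLike.mem_coe, Ideal.mem_comap, galInt_natCast σ p]
    exact Ideal.mem_span_singleton_self _

/-- `galModP σ` on residue classes. [folklore] -/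
@[simp] theorem galModP_mk (σ : absoluteGaloisGroup F) (x : integerC F) :
    galModP (p := p) σ (Ideal.Quotient.mk (Ideal.span {(p : integerC F)}) x) =
      Ideal.Quotient.mk (Ideal.span {(p : integerC F)}) (galInt σ x) := rfl

/-- `galModP 1 = id`. [folklore] -/
theorem galModP_one (x : ModP (integerC F) p) : galModP (1 : absoluteGaloisGroup F) x = x := by
  induction x using Quotient.inductionOn' with
  | h r =>
    change galModP (p := p) 1 (Ideal.Quotient.mk (Ideal.span {(p : integerC F)}) r) =
      Ideal.Quotient.mk (Ideal.span {(p : integerC F)}) r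
    rw [galModP_mk, galInt_one]

/-- `galModP (σ τ) = galModP σ ∘ galModP τ`. [folklore] -/
theorem galModP_mul (σ τ : absoluteGaloisGroup F) (x : ModP (integerC F) p) :
    galModP (σ * τ) x = galModP σ (galModP τ x) := by
  induction x using Quotient.inductionOn' with
  | h r =>
    change galModP (p := p) (σ * τ) (Ideal.Quotient.mk (Ideal.span {(p : integerC F)}) r) =
      galModP (p := p) σ (galModP (p := p) τ (Ideal.Quotient.mk (Ideal.span {(p : integerC F)}) r))
    rw [galModP_mk, galModP_mk, galModP_mk, galInt_mul]

variable [Fact p.Prime]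

section ModP

variable [Fact (¬ IsUnit (p : integerC F))]

/-! ### The action on the tilt `𝒪_{ℂ_F}♭` -/

/-- **`σ♭`**: the ring endomorphism of the tilt `𝒪_{ℂ_F}♭ = lim_{x ↦ x^p} 𝒪_{ℂ_F}/p` induced
coefficientwise by `σ mod p` (Mathlib `Perfection.map`). [cite: FontaineAsterisque223III, Exp. II §1.2]
[cite: FontaineOuyang2022, §4.3] -/
def galTilt (σ : absoluteGaloisGroup F) : PreTilt (integerC F) p →+* PreTilt (integerC F) p :=
  Perfection.map p (galModP σ)

/-- Coefficients of `σ♭ x`. [folklore] -/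
@[simp] theorem coeff_galTilt (σ : absoluteGaloisGroup F) (x : PreTilt (integerC F) p) (n : ℕ) :
    PreTilt.coeff n (galTilt σ x) = galModP σ (PreTilt.coeff n x) := rfl

/-- `galTilt 1 = id`. [folklore] -/
theorem galTilt_one (x : PreTilt (integerC F) p) : galTilt (1 : absoluteGaloisGroup F) x = x := by
  refine Perfection.ext fun n => ?_
  change PreTilt.coeff n (galTilt 1 x) = PreTilt.coeff n x
  rw [coeff_galTilt, galModP_one]

/-- `galTilt (σ τ) = galTilt σ ∘ galTilt τ`. [folklore] -/
theorem galTilt_mul (σ τ : absoluteGaloisGroup F) (x : PreTilt (integerC F) p) :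
    galTilt (σ * τ) x = galTilt σ (galTilt τ x) := by
  refine Perfection.ext fun n => ?_
  change PreTilt.coeff n (galTilt (σ * τ) x) = PreTilt.coeff n (galTilt σ (galTilt τ x))
  rw [coeff_galTilt, coeff_galTilt, coeff_galTilt, galModP_mul]

/-- **The `Γ_F`-action on `𝒪_{ℂ_F}♭`** by ring automorphisms. [cite: FontaineAsterisque223III, Exp. II §1.2] -/
instance instMulSemiringActionPreTilt : MulSemiringAction (absoluteGaloisGroup F) (PreTilt (integerC F) p) where
  smul σ x := galTilt σ x
  one_smul x := galTilt_one x
  mul_smul σ τ x := galTilt_mul σ τ x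
  smul_zero σ := map_zero (galTilt σ)
  smul_add σ x y := map_add (galTilt σ) x y
  smul_one σ := map_one (galTilt σ)
  smul_mul σ x y := map_mul (galTilt σ) x y

/-- Unfolding of the action on the tilt. [folklore] -/
theorem smul_preTilt_def (σ : absoluteGaloisGroup F) (x : PreTilt (integerC F) p) : σ • x = galTilt σ x := rfl

/-! ### The action on `𝔸_inf(F)` -/

/-- **`𝕎(σ♭)`**: the ring endomorphism of `𝔸_inf(F) = 𝕎(𝒪_{ℂ_F}♭)` induced by `σ♭`
(functoriality of Witt vectors, Mathlib `WittVector.map`). [cite: FontaineAsterisque223III, Exp. II §1.2]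
[cite: FontaineOuyang2022, §4.4] -/
def galAinf (σ : absoluteGaloisGroup F) : Ainf (p := p) F →+* Ainf (p := p) F :=
  WittVector.map (galTilt σ)

/-- Witt coefficients of `𝕎(σ♭) x`. [folklore] -/
@[simp] theorem coeff_galAinf (σ : absoluteGaloisGroup F) (x : Ainf (p := p) F) (n : ℕ) :
    (galAinf σ x).coeff n = galTilt σ (x.coeff n) :=
  WittVector.map_coeff _ _ _

/-- `𝕎(σ♭)` on Teichmüller representatives. [folklore] -/
theorem galAinf_teichmuller (σ : absoluteGaloisGroup F) (x : PreTilt (integerC F) p) :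
    galAinf σ (teichmuller p x) = teichmuller p (galTilt σ x) :=
  WittVector.map_teichmuller p (galTilt σ) x

/-- `galAinf 1 = id`. [folklore] -/
theorem galAinf_one (x : Ainf (p := p) F) : galAinf (1 : absoluteGaloisGroup F) x = x := by
  refine WittVector.ext fun n => ?_
  rw [coeff_galAinf, galTilt_one]

/-- `galAinf (σ τ) = galAinf σ ∘ galAinf τ`. [folklore] -/
theorem galAinf_mul (σ τ : absoluteGaloisGroup F) (x : Ainf (p := p) F) :
    galAinf (σ * τ) x = galAinf σ (galAinf τ x) := by
  refine WittVector.ext fun n => ?_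
  rw [coeff_galAinf, coeff_galAinf, coeff_galAinf, galTilt_mul]

/-- **The `Γ_F`-action on `𝔸_inf(F)`** by ring automorphisms. [cite: FontaineAsterisque223III, Exp. II §1.2] -/
instance instMulSemiringActionAinf : MulSemiringAction (absoluteGaloisGroup F) (Ainf (p := p) F) where
  smul σ x := galAinf σ x
  one_smul x := galAinf_one x
  mul_smul σ τ x := galAinf_mul σ τ x
  smul_zero σ := map_zero (galAinf σ)
  smul_add σ x y := map_add (galAinf σ) x y
  smul_one σ := map_one (galAinf σ)
  smul_mul σ x y := map_mul (galAinf σ) x y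

/-- Unfolding of the action on `𝔸_inf(F)`. [folklore] -/
theorem smul_ainf_def (σ : absoluteGaloisGroup F) (x : Ainf (p := p) F) : σ • x = galAinf σ x := rfl

/-- The action on `𝔸_inf(F)` commutes with the Witt vector Frobenius `φ`. [cite: FontaineOuyang2022, §4.4] -/
theorem galAinf_frobenius (σ : absoluteGaloisGroup F) (x : Ainf (p := p) F) :
    galAinf σ (WittVector.frobenius x) = WittVector.frobenius (galAinf σ x) := by
  refine WittVector.ext fun n => ?_
  rw [coeff_galAinf, WittVector.coeff_frobenius_charP, WittVector.coeff_frobenius_charP, coeff_galAinf,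
    map_pow]

/-! ### Equivariance of `♯` and of `θ` -/

variable [CharZero F] [IsAdicComplete (Ideal.span {(p : integerC F)}) (integerC F)]

omit [Fact p.Prime] [Fact (¬ IsUnit (p : integerC F))] [IsAdicComplete (Ideal.span {(p : integerC F)}) (integerC F)] in
/-- `galInt σ` maps `(p)^n` into itself. [folklore] -/
theorem galInt_mem_span_natCast_pow (hp0 : p ≠ 0) (σ : absoluteGaloisGroup F) (n : ℕ) {x : integerC F}
    (hx : x ∈ Ideal.span {(p : integerC F)} ^ n) : galInt σ x ∈ Ideal.span {(p : integerC F)} ^ n :=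
  galInt_mem_span_pow σ (by rw [coe_natCast_integerC]; exact natCast_C_ne_zero hp0) n hx


/-- **The sharp map is `Γ_F`-equivariant**: `(σ♭ x)♯ = σ (x♯)` — both sides are limits of
`pⁿ`-th powers of lifts of the coefficients, and `σ` is an isometry (uniqueness of the
Teichmüller lift, Mathlib `Perfection.teichmuller_spec`). [cite: FontaineAsterisque223III, Exp. II §1.2]
[cite: FontaineOuyang2022, Prop. 4.3.2] -/
theorem untilt_galTilt (σ : absoluteGaloisGroup F) (x : PreTilt (integerC F) p) :
    PreTilt.untilt (galTilt σ x) = galInt σ (PreTilt.untilt x) := by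
  have hp0 : p ≠ 0 := (Fact.out : p.Prime).ne_zero
  change Perfection.teichmuller p (Ideal.span {(p : integerC F)}) (galTilt σ x) = _
  refine Perfection.teichmuller_spec fun n => ?_
  set z₀ : integerC F := (PreTilt.coeff n x).out
  have hz₀ : Ideal.Quotient.mk (Ideal.span {(p : integerC F)}) z₀ = Perfection.coeff _ p n x :=
    Ideal.Quotient.mk_out _
  refine ⟨galInt σ z₀, ?_, ?_⟩
  · change galModP σ (Ideal.Quotient.mk _ z₀) = galModP σ (PreTilt.coeff n x)
    rw [hz₀]; rfl
  · have h1 : Perfection.teichmuller p (Ideal.span {(p : integerC F)}) x ≡ z₀ ^ p ^ n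
        [SMOD Ideal.span {(p : integerC F)} ^ (n + 1)] := Perfection.teichmuller_sModEq hz₀
    rw [SModEq.sub_mem] at h1 ⊢
    have h2 := galInt_mem_span_natCast_pow hp0 σ (n + 1) h1
    rw [map_sub, map_pow] at h2
    rw [← neg_sub]
    exact Submodule.neg_mem _ h2

/-- **Fontaine's `θ` is `Γ_F`-equivariant**: `θ (𝕎(σ♭) x) = σ (θ x)` for all `x ∈ 𝔸_inf(F)`.
Proof: modulo each `p^(n+1)` both sides are ring maps `𝕎(𝒪_{ℂ_F}♭) → 𝒪_{ℂ_F}/p^(n+1)` agreeing on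
Teichmüller representatives (`θ [x] = x♯` and `untilt_galTilt`), hence equal (Mathlib
`WittVector.eq_of_apply_teichmuller_eq`); conclude by `p`-adic separatedness.
[cite: FontaineAsterisque223III, Exp. II §1.2] [cite: FontaineOuyang2022, §4.4] -/
theorem fontaineTheta_galAinf (σ : absoluteGaloisGroup F) (x : Ainf (p := p) F) :
    fontaineTheta (integerC F) p (galAinf σ x) = galInt σ (fontaineTheta (integerC F) p x) := by
  refine eq_of_forall_sub_mem_span_natCast_pow p fun n => ?_
  cases n with
  | zero => rw [pow_zero, Ideal.one_eq_top]; exact Submodule.mem_top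
  | succ n =>
    set I : Ideal (integerC F) := Ideal.span {(p : integerC F)} with hI
    let f : Ainf (p := p) F →+* integerC F ⧸ I ^ (n + 1) :=
      (Ideal.Quotient.mk (I ^ (n + 1))).comp ((fontaineTheta (integerC F) p).comp (galAinf σ))
    let g : Ainf (p := p) F →+* integerC F ⧸ I ^ (n + 1) :=
      (Ideal.Quotient.mk (I ^ (n + 1))).comp ((galInt σ).comp (fontaineTheta (integerC F) p))
    have hfg : f = g := by
      refine WittVector.eq_of_apply_teichmuller_eq f g (isNilpotent_natCast_quotient_pow n) fun y => ?_
      change Ideal.Quotient.mk _ (fontaineTheta (integerC F) p (galAinf σ (teichmuller p y))) =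
        Ideal.Quotient.mk _ (galInt σ (fontaineTheta (integerC F) p (teichmuller p y)))
      rw [galAinf_teichmuller, fontaineTheta_teichmuller, fontaineTheta_teichmuller, untilt_galTilt]
    have := congrArg (fun φ => φ x) hfg
    change Ideal.Quotient.mk _ (fontaineTheta (integerC F) p (galAinf σ x)) =
      Ideal.Quotient.mk _ (galInt σ (fontaineTheta (integerC F) p x)) at this
    rwa [Ideal.Quotient.eq] at this

/-- `θ (σ • x) = σ (θ x)`. [cite: FontaineAsterisque223III, Exp. II §1.2] -/
theorem fontaineTheta_smul (σ : absoluteGaloisGroup F) (x : Ainf (p := p) F) :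
    fontaineTheta (integerC F) p (σ • x) = galInt σ (fontaineTheta (integerC F) p x) :=
  fontaineTheta_galAinf σ x

/-- **`ker θ` is `Γ_F`-stable.** [cite: FontaineAsterisque223III, Exp. II §1.2] -/
theorem galAinf_mem_ker_fontaineTheta (σ : absoluteGaloisGroup F) {x : Ainf (p := p) F}
    (hx : x ∈ RingHom.ker (fontaineTheta (integerC F) p)) :
    galAinf σ x ∈ RingHom.ker (fontaineTheta (integerC F) p) := by
  rw [RingHom.mem_ker] at hx ⊢
  rw [fontaineTheta_galAinf, hx, _root_.map_zero]

/-- `Γ_F` maps `(ker θ)^n` into itself. [cite: FontaineAsterisque223III, Exp. II §1.2] -/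
theorem galAinf_mem_ker_fontaineTheta_pow (σ : absoluteGaloisGroup F) : ∀ (n : ℕ) {x : Ainf (p := p) F},
    x ∈ RingHom.ker (fontaineTheta (integerC F) p) ^ n →
      galAinf σ x ∈ RingHom.ker (fontaineTheta (integerC F) p) ^ n
  | 0, x, _ => by rw [pow_zero, Ideal.one_eq_top]; exact Submodule.mem_top
  | n + 1, x, hx => by
    rw [pow_succ] at hx ⊢
    refine Submodule.mul_induction_on hx (fun a ha b hb => ?_) (fun a b ha hb => ?_)
    · rw [map_mul]
      exact Ideal.mul_mem_mul (galAinf_mem_ker_fontaineTheta_pow σ n ha) (galAinf_mem_ker_fontaineTheta σ hb)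
    · rw [map_add]
      exact Submodule.add_mem _ ha hb

end ModP

end Literature.NumberTheory.PAdicHodge

end
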